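import Summits.ResolutionOfSingularities.ResolutionOfSingularities.Theorems.JetCutPoint
import HarnessLib

/-!
# JetCutTame — decomp-res node «JetCut» (lens-2 g15 rev 5)

Content VERBATIM from the decomp-res lens-2 file `HOME/decomp-res-lens-2/g15/JetCut.lean` rev 5 (pin 9f53e5ca =
`parts/JetCut-rev5-9f53e5ca.lean`, 7 495 l;
HOME = run/shared/lean/pub/decomp-res; CRITIC-LEDGER rows 109 / 115 / 120 / 121 / 122 / 127 / 133 CLEARED; landing
order INBOX :231; the critic's
HYGIENE-landing.md h1–h11 applied — DOCSTRING-ONLY).  The lens's blocks RESTATED VERBATIM from lens-2 g12 / g13 /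
g14 (§R / §R13 / §R14) are DELETED:
they are the tree's `RelativeDeltaCut*` / `CurveLeafExit*` / `PinchCut*` modules (namespaces `RelativeDeltaCut`,
`CurveLeafExit`, `PinchCut`, opened;
the lens's `CurveLeafExitRestated.x` / `PinchCutRestated.x` are cited as `CurveLeafExit.x` / `PinchCut.x`, the three
pointwise engine edges of g12 as
`RelativeDeltaCut.x`).  Namespace `…Theorems.JetCut` (the lens's `Theses.JetCut` is gate-reserved), sub-namespaces
`Tame` / `Wide` / `Broad` / `Vast`
as in the lens; file split only (tree files ≤ 400 lines): sections, variables and every declaration exactly as in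
the lens, the long rev-0/1 prose
lives in HOME/decomp-res-lens-2/g15/NODE-g15.md §ARCHIVE-A (not in the tree).  Node files, in import order:
`JetCutJetKernels`, `JetCutPoint`, `JetCutClasses`, `JetCutKernels`, `JetCutTame`, `JetCutTameClasses`,
`JetCutTameKernels`, `JetCutLadder`, `JetCutWideClasses`, `JetCutWideKernels`, `JetCutMixed`, `JetCutBroadClasses`,
`JetCutBroadKernels`, `JetCutDegenerate`, `JetCutVastClasses`, `JetCutVastKernels`
(each possibly continued `…2`, `…3`), then the wiring `MaxContactCutJetCut*` (in the Theses cone).  All `--supports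
stmt-ResolutionOfSingularities-29273`
(`MaxContactCut.RungOne`); nothing closes 29273 — decided cells carry their engines as hypotheses, and exactly ONE
located-residual aside is booked on
the route for this column (`Vast.VastSpecialRung`, home `JetCutVastClasses`).

§T (rev 2): the TAME BRANCH — the VERTEX LEMMA (`section VertexLemma`: a pure `n`-th power of a linear form
involving a fibre variable is impossible for the tame initial forms, PROVED), the tame ring test (`section
TameRing`), and §T2 point level: jet-tame closed points `IsJetTameAt`, uniformly jet-tame curves, ENGINE (T)
`JetTameExit` (with the FRAME NOTE and the PAIR form of τ-generisation, HYGIENE h1/h2), the classes (jet-tame-curve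
/ tame-special points) and their pointwise kernels; the tame bed-row arithmetic.

(Sources: HunekeSwanson2006 Cor. 5.5.5; CossartJannsenSaito2020 Ch. 2, Thm. 3.6/3.7, Ch. 8; CossartPiltant2008 Prop.
4.2; CossartPiltant2019 Rem. 3.2; Hironaka1964 Ch. III; Hironaka1967; Hironaka1977; Moh1987; Giraud1975.)
-/

open CategoryTheory AlgebraicGeometry TopologicalSpace IsLocalRing
open Literature.AlgebraicGeometry.Resolution
open Summit.ResolutionOfSingularities.ResolutionOfSingularities.Theorems
open Summit.ResolutionOfSingularities.ResolutionOfSingularities.Theorems.WeakOrderReduction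
open Summit.ResolutionOfSingularities.ResolutionOfSingularities.Theorems.DeltaFaceCutClasses
open Summit.ResolutionOfSingularities.ResolutionOfSingularities.Theorems.RelativeDeltaCut
open Summit.ResolutionOfSingularities.ResolutionOfSingularities.Theorems.CurveLeafExit
open Summit.ResolutionOfSingularities.ResolutionOfSingularities.Theorems.PinchCut

namespace Summit.ResolutionOfSingularities.ResolutionOfSingularities.Theorems.JetCut

section VertexLemma

variable {K : Type} [Field K] {m : ℕ}

/-! ## §T  NEW (g15, rev 2): the TAME BRANCH — class-≥-2 near points are EXITS.  `PackageExitsOver` (g11/g12, the port's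
hypothesis shape) asks only `τ ≥ 2` at the points of order `n` over the curve after the package — NOT «no near point».
So the one-step test widens from (J) «no point of order `n` over `y`» to (T) «every point of order `n` over `y` has an
initial form involving a FIBRE DIRECTION», which forces `τ(x') ≥ 2` by the VERTEX LEMMA below; such near points are
handed to `E 2` by the unchanged port.  Census T-jet-branch (2026-08-30T16:02Z, 14 two-parameter probes): «≥ 2 near
points over `y` occur only for `n = 2` with a `v`-linear degree-2 cone factor `u₁u₂` (near points at its roots, initial
forms `z² + v·u`), and EVERY branch point is Top-ISOLATED after the blow-up» — exactly the tame branch.  Bed row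
`branch:2`: `z² + v·u₁u₂ + u₁⁵ + u₂⁵` (`p = 2`, `𝔸⁴`, `C` = `v`-axis = Top, core point at the origin, class-≥-2 points
at `v ≠ 0`): chart `u₁` at `θ = (1:0)`: `X₀² + v·X₂ + u₁³(1 + X₂⁵)` has ORDER 2 at `X₂ = 0` — a near point, so NOT
jet-shallow — with initial form `X₀² + vX₂ ∌ k[X₀, v, u₁]`: TAME (`τ = 3`); chart `u₂` symmetric; chart `z` unit; at
`v = a ≠ 0` the term `vX₂` has order 1: shallow.  So `branch:2` is jet-special and NOT tame-special: the residual
shrinks strictly on the bed (critic row 109 r3: «tails in ≥ 2 transversal parameters (branching near points)»).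

VERTEX LEMMA (pure algebra; PROVED IN KERNEL below: `vertex_lemma`, `mem_supported_of_vertex`,
`linearForm_mem_supported_of_vertex`, + the `branch:2` bed instance).  Let `N ∈ K[X₀, v, u, π₁, …, π_e]` be a form
of degree `n` with
`N ≡ X₀ⁿ (mod (v, u))`.  If `N = λ·ℓⁿ` for a linear form `ℓ = αX₀ + βv + γu + Σ δ_kπ_k`, then setting `v = u = 0` gives
`X₀ⁿ = λ(αX₀ + Σ δ_kπ_k)ⁿ`, whose `π_kⁿ`-coefficient is `λδ_kⁿ = 0`, so every `δ_k = 0` and `ℓ ∈ span(X₀, v, u)`.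
CONSEQUENCE at a point `x'` of the chart-`j` fibre over a CORE point `y` (`X₀ ∈ 𝔐`; `(u_j, X₀, v, π)` a regular system
of parameters of `𝒪_{Y₁,x'}`, `π` lifting generators of `𝔑`): the vertex presentation `F₀ = X₀ⁿ + (coefficients in
𝔪_y)` has transform `h'₀ ≡ X₀ⁿ (mod (u_j, v))`, so if `ord_{x'} I₁ = n` and `τ(x') = 1` with directrix `span(ℓ)` then
`in_n(h'₀) = λℓⁿ` forces `ℓ ∈ span(X₀, v, u_j)` and ALL degree-`n` initial forms of `I₁` at `x'` lie in
`k(x')[X₀, v, u_j]`, i.e. every `h ∈ I₁` lies in `(X₀, v, u_j)ⁿ + 𝔪_{x'}ⁿ⁺¹`; contrapositively a witness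
`dehomog_j F ∉ chartRel + 𝔐ⁿ⁺¹ + (X₀, c_j, v)ⁿ` with `F(c) ∈ I_y` gives `ord_{x'} I₁ < n` OR `τ(x') ≥ 2`.  Over the
generic point `η` of `C`: a point `ξ'` of order `n` over `η` specialises (properness) to near points over closed points
at which its closure is regular somewhere; `τ` does not drop under generisation inside the top locus
(CossartJannsenSaito2020 Thm 3.6/3.7: `e_η(X) ≤ e_x(X) − dim 𝒪_{D,x}` for `D = closure {η}` permissible at `x`,
i.e. `τ(x) ≤ τ(η)`; Hironaka1977 (idealistic exponents) for the PAIR form `τ(I, n)` — which follows from the scheme form by the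
10-line lattice argument: Dir of the initial forms of `(I, n)` at `η` contains the image of Dir at `x` modulo the tangent
space of `D` — HYGIENE h2), so `τ(ξ') ≥ 2` as well — port ingredient NAMED, as the
semicontinuity of order was for (J).  [cite: Hironaka1964 Ch. III; Hironaka1967; CossartJannsenSaito2020 Ch. 2 (directrix,
near points, Thm 2.14), Ch. 8; CossartPiltant2008 Prop. 4.2 (a)–(b); BierstoneGrigorievMilmanWlodarczyk2011 Def. 3.1.3] -/

/-- Evaluation of a linear form at a coordinate point picks the coefficient.  KERNEL (PROVED). [folklore] -/
theorem eval_indicator_linearForm (a : Fin m → K) (k : Fin m) :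
    MvPolynomial.eval (fun i => if i = k then (1 : K) else 0)
        (∑ i, MvPolynomial.C (a i) * MvPolynomial.X i : MvPolynomial (Fin m) K) = a k := by
  simp [map_sum, MvPolynomial.eval_C, MvPolynomial.eval_X, Finset.sum_ite_eq', Finset.mem_univ]

/-- **VERTEX LEMMA** [rev 2; KERNEL (PROVED) — the algebraic heart of the tame criterion (T)].  In `K[X_0, …, X_{m-1}]`
let `S` be a set of «base» variables containing `i₀` (on the blow-up chart: `S = {X₀, v, u_j}`, `i₀ = X₀`, the other
variables `π_k` lifting generators of `𝔑 = 𝔪_y R[U]/(chart) + …`).  If `N ≡ X_{i₀}ⁿ` modulo the ideal of the OTHER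
base variables and `N = c·ℓⁿ` (`c ≠ 0`, `n ≥ 1`) for a linear form `ℓ = Σ aᵢXᵢ`, then `ℓ` involves base variables
only: `a_k = 0` for every `k ∉ S` (evaluate at the `k`-th coordinate point: `0 = c·a_kⁿ`).  On paper this is the
step «vertex transform `h'₀ ≡ X₀ⁿ (mod (u_j, v))` + `τ(x') = 1` with directrix `Kℓ` ⇒ `ℓ ∈ span(X₀, v, u_j)`».
[folklore; used as in Hironaka1964 Ch. III §3 (directrix), CossartJannsenSaito2020 Ch. 2] [folklore] -/
theorem vertex_lemma (S : Set (Fin m)) {i₀ : Fin m} (hi₀ : i₀ ∈ S) {n : ℕ} (hn : n ≠ 0) (a : Fin m → K)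
    {c : K} (hc : c ≠ 0) {N : MvPolynomial (Fin m) K}
    (hN : N - MvPolynomial.X i₀ ^ n ∈
      Ideal.span ((fun i => (MvPolynomial.X i : MvPolynomial (Fin m) K)) '' (S \ {i₀})))
    (hNℓ : N = MvPolynomial.C c * (∑ i, MvPolynomial.C (a i) * MvPolynomial.X i) ^ n) :
    ∀ k, k ∉ S → a k = 0 := by
  intro k hk
  have hker : Ideal.span ((fun i => (MvPolynomial.X i : MvPolynomial (Fin m) K)) '' (S \ {i₀})) ≤
      RingHom.ker (MvPolynomial.eval (fun i => if i = k then (1 : K) else 0)) := by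
    rw [Ideal.span_le]
    rintro _ ⟨i, hi, rfl⟩
    have hik : i ≠ k := fun h => hk (h ▸ hi.1)
    simp [RingHom.mem_ker, MvPolynomial.eval_X, hik]
  have hi₀k : i₀ ≠ k := fun h => hk (h ▸ hi₀)
  have h1 : MvPolynomial.eval (fun i => if i = k then (1 : K) else 0) (N - MvPolynomial.X i₀ ^ n) = 0 := hker hN
  have h3 : MvPolynomial.eval (fun i => if i = k then (1 : K) else 0) N = 0 := by
    rw [map_sub, map_pow, MvPolynomial.eval_X] at h1
    simpa [hi₀k, zero_pow hn] using h1
  have h2 : MvPolynomial.eval (fun i => if i = k then (1 : K) else 0) N = c * a k ^ n := by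
    rw [hNℓ, map_mul, MvPolynomial.eval_C, map_pow, eval_indicator_linearForm]
  rw [h2] at h3
  rcases mul_eq_zero.mp h3 with h | h
  · exact absurd h hc
  · exact (pow_eq_zero_iff hn).mp h

/-- **τ ≥ 2 TEMPLATE** [rev 2; KERNEL (PROVED)].  Under the vertex lemma's hypotheses, ANY `K`-multiple `G = μ·ℓⁿ` of
the directrix power lies in the subalgebra `K[X_i : i ∈ S]` of the base variables (`MvPolynomial.supported K S`).
Read contrapositively on the chart (`S = {X₀, v, u_j}`, `K = k(x')`, the graded ring of `𝒪_{Y₁,x'}`): if `τ(x') = 1`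
— every degree-`n` initial form of `I₁` at `x'` is a multiple of one `ℓⁿ` — then every such initial form lies in
`k(x')[X̄₀, v̄, ū_j]`, i.e. every `h ∈ I₁` of order `n` lies in `(X₀, v, u_j)ⁿ + 𝔪_{x'}ⁿ⁺¹`; so a witness
`dehomog_j F ∉ chartRel + 𝔐ⁿ⁺¹ + (X₀, c_j, v)ⁿ` (the second branch of `JetTame`) forces `ord_{x'} I₁ < n ∨ τ(x') ≥ 2`.
[folklore; Hironaka1964 Ch. III §3; CossartJannsenSaito2020 Ch. 2 (directrix, `e_x`)] [folklore] -/
theorem mem_supported_of_vertex (S : Set (Fin m)) {i₀ : Fin m} (hi₀ : i₀ ∈ S) {n : ℕ} (hn : n ≠ 0)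
    (a : Fin m → K) {c : K} (hc : c ≠ 0) {N : MvPolynomial (Fin m) K}
    (hN : N - MvPolynomial.X i₀ ^ n ∈
      Ideal.span ((fun i => (MvPolynomial.X i : MvPolynomial (Fin m) K)) '' (S \ {i₀})))
    (hNℓ : N = MvPolynomial.C c * (∑ i, MvPolynomial.C (a i) * MvPolynomial.X i) ^ n)
    {G : MvPolynomial (Fin m) K} {μ : K}
    (hG : G = MvPolynomial.C μ * (∑ i, MvPolynomial.C (a i) * MvPolynomial.X i) ^ n) :
    G ∈ MvPolynomial.supported K S := by
  have ha := vertex_lemma S hi₀ hn a hc hN hNℓ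
  have hCmem : ∀ r : K, (MvPolynomial.C r : MvPolynomial (Fin m) K) ∈ MvPolynomial.supported K S := by
    intro r
    have h := Subalgebra.algebraMap_mem (MvPolynomial.supported K S) r
    rwa [MvPolynomial.algebraMap_eq] at h
  have hℓ : (∑ i, MvPolynomial.C (a i) * MvPolynomial.X i : MvPolynomial (Fin m) K) ∈
      MvPolynomial.supported K S := by
    refine Subalgebra.sum_mem _ fun i _ => ?_
    by_cases hi : i ∈ S
    · exact Subalgebra.mul_mem _ (hCmem (a i)) (MvPolynomial.mem_supported.2 (by
        simpa [MvPolynomial.vars_X] using hi))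
    · simp [ha i hi]
  rw [hG]
  exact Subalgebra.mul_mem _ (hCmem μ) (Subalgebra.pow_mem _ hℓ n)

/-- The directrix line itself lies in the base variables (case `μ = 1`, `G = ℓⁿ` with `n = 1` read through
`vertex_lemma`): `ℓ ∈ K[X_i : i ∈ S]`.  KERNEL (PROVED). [folklore] -/
theorem linearForm_mem_supported_of_vertex (S : Set (Fin m)) {i₀ : Fin m} (hi₀ : i₀ ∈ S) {n : ℕ} (hn : n ≠ 0)
    (a : Fin m → K) {c : K} (hc : c ≠ 0) {N : MvPolynomial (Fin m) K}
    (hN : N - MvPolynomial.X i₀ ^ n ∈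
      Ideal.span ((fun i => (MvPolynomial.X i : MvPolynomial (Fin m) K)) '' (S \ {i₀})))
    (hNℓ : N = MvPolynomial.C c * (∑ i, MvPolynomial.C (a i) * MvPolynomial.X i) ^ n) :
    (∑ i, MvPolynomial.C (a i) * MvPolynomial.X i : MvPolynomial (Fin m) K) ∈ MvPolynomial.supported K S := by
  have ha := vertex_lemma S hi₀ hn a hc hN hNℓ
  refine Subalgebra.sum_mem _ fun i _ => ?_
  by_cases hi : i ∈ S
  · have h := Subalgebra.algebraMap_mem (MvPolynomial.supported K S) (a i)
    rw [MvPolynomial.algebraMap_eq] at h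
    exact Subalgebra.mul_mem _ h (MvPolynomial.mem_supported.2 (by simpa [MvPolynomial.vars_X] using hi))
  · simp [ha i hi]

/-- Bed instance of the CONTRAPOSITIVE use (`branch:2`, chart `u₁`; variables `X₀ ↦ 0, v ↦ 1, u₁ ↦ 2, X₂ ↦ 3`,
`S = {0, 1, 2}`): the near point's initial form `X₀² + v·X₂` involves the fibre variable `X₂ ∉ S`, so it is NOT in
`K[X₀, v, u₁]` — by `mem_supported_of_vertex` it is no multiple of a directrix power `ℓⁿ` with vertex: the point is
tame (`τ ≥ 2`), not shallow.  KERNEL (PROVED: two evaluations agreeing on `S` differ). -/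
example : (MvPolynomial.X 0 ^ 2 + MvPolynomial.X 1 * MvPolynomial.X 3 : MvPolynomial (Fin 4) ℚ) ∉
    MvPolynomial.supported ℚ ({0, 1, 2} : Set (Fin 4)) := by
  intro h
  have hv := MvPolynomial.mem_supported.1 h
  have key := MvPolynomial.eval₂Hom_congr' (f₁ := RingHom.id ℚ) (f₂ := RingHom.id ℚ)
      (g₁ := fun i : Fin 4 => if i = 1 ∨ i = 3 then (1 : ℚ) else 0) (g₂ := fun i : Fin 4 => if i = 1 then (1 : ℚ) else 0)
      (p₁ := (MvPolynomial.X 0 ^ 2 + MvPolynomial.X 1 * MvPolynomial.X 3 : MvPolynomial (Fin 4) ℚ)) rfl ?_ rfl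
  · simp at key
  · intro i hi _
    have hi' : i ∈ ({0, 1, 2} : Set (Fin 4)) := hv hi
    fin_cases i <;> simp at hi' ⊢

end VertexLemma

section TameRing

variable {R : Type} [CommRing R] {d : ℕ}

/-- **JET-TAME = the ONE-STEP EXIT TEST WITH CLASS-≥-2 NEAR POINTS ALLOWED** [rev 2; EXACT-ON-PAPER] (`JetTame M c v J n`,
`M = 𝔪_y`, `c = (z, u₁, …, u_d)` with `z = c 0`, `v` the inert parameter, `J = I_y`): at every chart `j` and every
closed point `𝔐` of the chart-`j` exceptional fibre over `y` (phantom convention of §J1), EITHER the jet test passes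
(some `dehomog_j F ∉ chartRel + 𝔐ⁿ`: order `< n` at `x'`) OR [a VERTEX presentation exists — a degree-`n` form
`F₀` with `F₀(c) ∈ J` and `F₀ − X₀ⁿ` with all coefficients in `M` (automatic at a CORE point: `in_n = Zⁿ`) — AND some
degree-`n` form `F` with `F(c) ∈ J` has `dehomog_j F ∉ chartRel + 𝔐ⁿ⁺¹ + (X₀, c_j, v)ⁿ`: its transform has order
`≤ n` at `x'` with degree-`n` initial form NOT in `k(x')[X₀, v, u_j]`, i.e. involving a fibre direction].  By the VERTEX
LEMMA (PROVED: `vertex_lemma`, `mem_supported_of_vertex`) the second branch gives `ord_{x'} I₁ < n ∨ τ(x') ≥ 2`.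
(If `X₀ ∉ 𝔐` the ideal
`(X₀, c_j, v)ⁿ + 𝔐ⁿ⁺¹` is the unit ideal, so the second branch is silently false there and the first must hold — as it
does over a core point: `X₀ⁿ` is a unit.)  HENCE on a regular `Y` with `I_y ⊆ (c)ⁿ`: `JetTame 𝔪 c v I_y n ⟹` after
blowing up `V(c)` every point of `Y₁` over `y` of order `n` has `τ ≥ 2` (class ≥ 2) — EXACT-ON-PAPER.  By letter
`JetShallow ⟹ JetTame` (`jetTame_of_jetShallow`).  DEFINITION (NEW class predicate: the one-step tame criterion).
(Sources: Hironaka1964 Ch. III; CossartJannsenSaito2020 Ch. 2, Ch. 8; CossartPiltant2008 Prop. 4.2.) -/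
def JetTame (M : Ideal R) (c : Fin (d + 1) → R) (v : R) (J : Ideal R) (n : ℕ) : Prop :=
  ∀ (j : Fin (d + 1)) (Q : Ideal (MvPolynomial (Fin (d + 1)) R)), Q.IsMaximal →
    Ideal.map (MvPolynomial.C : R →+* MvPolynomial (Fin (d + 1)) R) M ≤ Q →
    (MvPolynomial.X j : MvPolynomial (Fin (d + 1)) R) ∈ Q →
      (∃ F : MvPolynomial (Fin (d + 1)) R, F.IsHomogeneous n ∧ MvPolynomial.eval c F ∈ J ∧
          dehomog j F ∉ chartRel c j ⊔ Q ^ n) ∨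
      ((∃ F₀ : MvPolynomial (Fin (d + 1)) R, F₀.IsHomogeneous n ∧ MvPolynomial.eval c F₀ ∈ J ∧
          ∀ m, (F₀ - MvPolynomial.X 0 ^ n).coeff m ∈ M) ∧
        ∃ F : MvPolynomial (Fin (d + 1)) R, F.IsHomogeneous n ∧ MvPolynomial.eval c F ∈ J ∧
          dehomog j F ∉ chartRel c j ⊔ Q ^ (n + 1) ⊔
            Ideal.span {(MvPolynomial.X 0 : MvPolynomial (Fin (d + 1)) R), MvPolynomial.C (c j),
              MvPolynomial.C v} ^ n)

/-- **(J) ⊆ (T) at ring level**: jet-shallow ⇒ jet-tame (first branch).  KERNEL (PROVED, by letter). [folklore] -/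
theorem jetTame_of_jetShallow (M : Ideal R) (c : Fin (d + 1) → R) (v : R) (J : Ideal R) (n : ℕ)
    (h : JetShallow M c J n) : JetTame M c v J n :=
  fun j Q hQ hM hX => Or.inl (h j Q hQ hM hX)

end TameRing

/-! ### §T2  point level — jet-tame closed points, uniformly jet-tame curves, ENGINE (T), the classes -/

/-- **JET-TAME at `y` transversal to `η`** [rev 2] (`IsJetTameAt I n η y`): the data of `IsJetShallowAt` (regular
parameters `c` generating the curve prime, inert `v`, `(c, v) = 𝔪_y` minimal, `I_y ⊆ (c)ⁿ`) and `JetTame 𝔪_y c v I_y n`.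
DEFINITION (NEW class predicate). (Sources: Hironaka1967; CossartJannsenSaito2020 Ch. 2, Ch. 8; CossartPiltant2008
Prop. 4.2.) -/
def IsJetTameAt {Y : Scheme.{0}} (I : Y.IdealSheafData) (n : ℕ) (η y : Y) : Prop :=
  ∃ h : η ⤳ y, ∃ (d : ℕ) (c : Fin (d + 1) → Y.presheaf.stalk y) (v : Y.presheaf.stalk y),
    Ideal.span (Set.range c) = curvePrime h ∧
      Ideal.span (Set.range c ∪ {v}) = maximalIdeal (Y.presheaf.stalk y) ∧
      (maximalIdeal (Y.presheaf.stalk y)).spanFinrank = d + 2 ∧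
      stalkIdeal I y ≤ Ideal.span (Set.range c) ^ n ∧
      JetTame (maximalIdeal (Y.presheaf.stalk y)) c v (stalkIdeal I y) n

/-- **UNIFORMLY JET-TAME CURVE** [rev 2] (`IsUniformJetTameCurve I n η`): `η` is a curve point and EVERY closed point of
`closure {η}` is jet-tame transversal to `η`.  The hypothesis of ENGINE (T).  DEFINITION (NEW class predicate).
(Sources: Hironaka1967; CossartJannsenSaito2020 Ch. 2.) -/
def IsUniformJetTameCurve {Y : Scheme.{0}} (I : Y.IdealSheafData) (n : ℕ) (η : Y) : Prop :=
  IsCurvePt η ∧ ∀ y : Y, η ⤳ y → IsClosed ({y} : Set Y) → IsJetTameAt I n η y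

/-- **ENGINE (T) `JetTameExit`** [rev 2; DECIDED · paper proof = (J)'s steps (0)–(2) of `JetExit` with «no point of order
`n`» replaced by «every point of order `n` over `C` has `τ ≥ 2`»: over closed points by `JetTame` and the VERTEX LEMMA,
over `η` (and at non-closed points) by properness + semicontinuity of order + NON-DROP OF `τ` UNDER GENERISATION
inside the top locus (port ingredient NAMED: Hironaka1977 (idealistic exponents: τ of the pair (I, n) does not drop
under generisation inside Top(I, n));
CossartJannsenSaito2020 Thm 3.6/3.7 is the scheme form `e_η(X) ≤ e_x(X) − dim 𝒪_{D,x}` for D ⊆ X permissible —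
the pair form follows by the 10-line lattice argument: Dir of the initial forms of (I, n) at η contains the image of
Dir at x modulo the tangent space of D) · every regular scheme, every residue field, every
`d`, every ideal · port L over `CentreSeq` / `controlledTransform` / `stalkTau`]: on a regular scheme, a uniformly
jet-tame curve of order `n ≥ 2` has an exit package with centres over it (its own blow-up).  By letter (T) CONTAINS
(J) (`jetExit_of_jetTameExit`), hence (C), (CT), (B).  FRAME NOTE (critic row 120 h1): the statement quantifies over
every regular scheme; the paper proof consumes (a) a regular CLOSED point on the closure of the generic point `ξ′` of the
transform's top curve (Jacobson / excellence — automatic in the frame actually consumed by `SeqTGen`: `k`-schemes locally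
of finite type) and (b) non-drop of `τ` under generisation inside the top locus in the PAIR form (h2 above).  Outside
excellent schemes the hypothesis `IsUniformJetTameCurve` is stronger than what is consumed (vacuity risk only in
non-excellent exotica).  STATEMENT (engine). (Sources: Hironaka1964; Hironaka1967; CossartJannsenSaito2020 Ch. 2,
Ch. 8; CossartPiltant2008 Prop. 4.2 (a)–(b).) -/
def JetTameExit : Prop :=
  ∀ (Y : Scheme.{0}), Scheme.IsRegular Y → ∀ (I : Y.IdealSheafData) (n : ℕ), 2 ≤ n →
    ∀ η : Y, IsUniformJetTameCurve I n η → PackageExitsOver I n {y : Y | η ⤳ y}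

/-- **JET-TAME-CURVE point** [rev 2] (NEW DECIDED CLASS, leaf (T)): `y` lies on (or is the generic point of) a
Top-isolated, uniformly jet-tame curve `closure {η}`.  DEFINITION (NEW class). (Sources: Hironaka1967;
CossartJannsenSaito2020 Ch. 2.) -/
def IsJetTameCurvePt {Y : Scheme.{0}} (I : Y.IdealSheafData) (n : ℕ) (y : Y) : Prop :=
  ∃ η : Y, η ⤳ y ∧ IsTopIsolatedClosure I n η ∧ IsUniformJetTameCurve I n η

/-- **TAME-SPECIAL core point** [rev 2] (THE REFINED LOCATED CLASS): pinch-special (g14) and NOT a jet-tame-curve point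
— on every Top-isolated regular clean curve through `y`, over SOME closed point a near point of order `n` with
`τ = 1` SURVIVES the blow-up of the curve (bed: `deeptail:2`, `deeptail:3`, binary towers; NOT `branch:2`).
By letter tame-special ⇒ jet-special (`isJetSpecialPt_of_isTameSpecialPt`).  DEFINITION (NEW class). (Sources:
folklore; CossartJannsenSaito2020 Ch. 2 (near and very near points).) -/
def IsTameSpecialPt {k : Type} [Field k] {Y : Scheme.{0}} (g : Y ⟶ Spec (.of k)) (hY : Scheme.IsRegular Y)
    (I : Y.IdealSheafData) (n : ℕ) (y : Y) : Prop :=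
  IsPinchSpecialPt g hY I n y ∧ ¬ IsJetTameCurvePt I n y

/-- **(J) ⊆ (T) at a closed point** [rev 2].  KERNEL (PROVED). [folklore] -/
theorem isJetTameAt_of_isJetShallowAt {Y : Scheme.{0}} {I : Y.IdealSheafData} {n : ℕ} {η y : Y} :
    IsJetShallowAt I n η y → IsJetTameAt I n η y := by
  rintro ⟨h, d, c, v, hc, hcv, hrank, hle, hJ⟩
  exact ⟨h, d, c, v, hc, hcv, hrank, hle, jetTame_of_jetShallow _ c v _ n hJ⟩

/-- **(J) ⊆ (T) along a curve** [rev 2].  KERNEL (PROVED). [folklore] -/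
theorem isUniformJetTameCurve_of_isUniformJetCurve {Y : Scheme.{0}} {I : Y.IdealSheafData} {n : ℕ} {η : Y} :
    IsUniformJetCurve I n η → IsUniformJetTameCurve I n η := by
  rintro ⟨hη, hall⟩
  exact ⟨hη, fun y hy hcl => isJetTameAt_of_isJetShallowAt (hall y hy hcl)⟩

/-- **(J) ⊆ (T) as classes** [rev 2]: every jet-curve point is a jet-tame-curve point.  KERNEL (PROVED). [folklore] -/
theorem isJetTameCurvePt_of_isJetCurvePt {Y : Scheme.{0}} {I : Y.IdealSheafData} {n : ℕ} {y : Y} :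
    IsJetCurvePt I n y → IsJetTameCurvePt I n y := by
  rintro ⟨η, hη, htop, hJ⟩
  exact ⟨η, hη, htop, isUniformJetTameCurve_of_isUniformJetCurve hJ⟩

/-- (C) ⊆ (T) as classes (g14's cone-curve points), marking `n ≥ 1`.  KERNEL (PROVED). [folklore] -/
theorem isJetTameCurvePt_of_isConeCurvePt {Y : Scheme.{0}} {I : Y.IdealSheafData} {n : ℕ} (hn : n ≠ 0) {y : Y} :
    IsConeCurvePt I n y → IsJetTameCurvePt I n y :=
  fun h => isJetTameCurvePt_of_isJetCurvePt (isJetCurvePt_of_isConeCurvePt hn h)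

/-- (CT) ⊆ (T) as classes (rev 1's cone-tail-curve points), marking `n ≥ 2`.  KERNEL (PROVED). [folklore] -/
theorem isJetTameCurvePt_of_isConeTailCurvePt {Y : Scheme.{0}} {I : Y.IdealSheafData} {n : ℕ} (hn : 2 ≤ n) {y : Y} :
    IsConeTailCurvePt I n y → IsJetTameCurvePt I n y :=
  fun h => isJetTameCurvePt_of_isJetCurvePt (isJetCurvePt_of_isConeTailCurvePt hn h)

/-- **ENGINE (T) implies ENGINE (J)** [rev 2]: whoever ports `JetTameExit` has ported `JetExit` (hence (C), (CT), (B)).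
KERNEL (PROVED). [folklore] -/
theorem jetExit_of_jetTameExit : JetTameExit → JetExit := by
  intro hT Y hY I n hn η hJ
  exact hT Y hY I n hn η (isUniformJetTameCurve_of_isUniformJetCurve hJ)

/-- ENGINE (T) implies g14's ENGINE (C).  KERNEL (PROVED). [folklore] -/
theorem flatConeExit_of_jetTameExit (hT : JetTameExit) : FlatConeExit :=
  flatConeExit_of_jetExit (jetExit_of_jetTameExit hT)

/-- ENGINE (T) implies rev 1's ENGINE (CT).  KERNEL (PROVED). [folklore] -/
theorem coneTailExit_of_jetTameExit (hT : JetTameExit) : ConeTailExit :=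
  coneTailExit_of_jetExit (jetExit_of_jetTameExit hT)

/-- Under ENGINE (T), every jet-tame-curve point is a curve-exit point (the port's hypothesis shape).  KERNEL
(PROVED). [folklore] -/
theorem isCurveExitPt_of_isJetTameCurvePt {Y : Scheme.{0}} {I : Y.IdealSheafData} {n : ℕ} {y : Y}
    (hT : JetTameExit) (hY : Scheme.IsRegular Y) (hn : 2 ≤ n) (h : IsJetTameCurvePt I n y) :
    IsCurveExitPt I n y := by
  obtain ⟨η, hηy, hiso, hcurve⟩ := h
  exact ⟨η, hηy, hcurve.1, hiso, hT Y hY I n hn η hcurve⟩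

/-- Tame-special ⇒ jet-special (the refined located class sits inside rev 0's).  KERNEL (PROVED). [folklore] -/
theorem isJetSpecialPt_of_isTameSpecialPt {k : Type} [Field k] {Y : Scheme.{0}} {g : Y ⟶ Spec (.of k)}
    {hY : Scheme.IsRegular Y} {I : Y.IdealSheafData} {n : ℕ} {y : Y} (h : IsTameSpecialPt g hY I n y) :
    IsJetSpecialPt g hY I n y :=
  ⟨h.1, fun hJ => h.2 (isJetTameCurvePt_of_isJetCurvePt hJ)⟩

/-- A jet-tame-curve point is never tame-special.  KERNEL (PROVED). [folklore] -/
theorem not_isTameSpecialPt_of_isJetTameCurvePt {k : Type} [Field k] {Y : Scheme.{0}} {g : Y ⟶ Spec (.of k)}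
    {hY : Scheme.IsRegular Y} {I : Y.IdealSheafData} {n : ℕ} {y : Y} (h : IsJetTameCurvePt I n y) :
    ¬ IsTameSpecialPt g hY I n y :=
  fun hs => hs.2 h

/-! ### Arithmetic of the tame bed row (one-step order bookkeeping) -/

example : ¬ (5 - 2 < 2) ∧ 2 ≤ 2 := by decide   -- branch:2 z²+v·u₁u₂+u₁⁵+u₂⁵ at θ=(1:0): X₀²+vX₂+u₁³(…) keeps order 2 (tame, not shallow)

end Summit.ResolutionOfSingularities.ResolutionOfSingularities.Theorems.JetCut
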